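import Literature.NumberTheory.Rogawski1990.StableClassesTypeTwoQuadraticBlock
import Literature.NumberTheory.QuadraticForms.HilbertSymbolRegularQuadraticExtension
import Literature.NumberTheory.Automorphic.QuadraticLocalNormGroupNonsplit
import HarnessLib

/-!
# The two norm inputs of the TYPE (2) local class count at a non-split place: in the `⋆`-algebra `E_v[A]` of the quadratic block, (N1) some `⋆`-symmetric
# element has NON-NORM determinant and (N2) a `⋆`-symmetric element with NORM determinant is itself a norm `S⋆S` (Rogawski 1990, §3.5 Prop. 3.5.2 (a), §3.6)

Topic `NumberTheory/Rogawski1990`; namespace `Literature.NumberTheory.Rogawski1990`.  THEOREMS ONLY (no definition, no named fact, no instance, no notation, no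
`sorry`).  Cell `pub/hodgecm-mathlib`, programme P3a, road «D-N7-inert» ([Rogawski1990, Prop. 4.9.1 (b)]), brick (L4a) «local class set», TYPE (2), the NORM half:
over ★ `StableClassesTypeTwoQuadraticBlock` (the square-root generator `κ` of `E_v[A]^⋆`, `κ² = k₀`, norm form `α′² − k₀β′²`), ★ `HilbertSymbolRegularQuadraticExtension`
(B-p14: a quadratic extension of `F_v` is a regular Hilbert field; norm functoriality) and ★ `QuadraticLocalNormGroupNonsplit` (B-p04: the unit-norm test in `E_v`-currency).
HC_CM is proved only modulo the printed citations until rung 0 closes; this file is unconditional local algebra.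

THE MATHEMATICS.  `E∕F` quadratic number fields (`c δ = −δ ≠ 0`, `δ² = d`), `v` a finite place NOT split in `E` (so `E_v = E ⊗ F_v` is a field, `σ = c ⊗ 1`), `G ∈ M₂(E_v)`
hermitian invertible, `A ∈ U(G)(F_v)` with `χ_A` rootless (the quadratic block of a type-(2) element).  [Rogawski1990, Prop. 3.5.2 (a)]: `H¹(F_v, T_K) = K^×∕N_{L′∕K}(L′^×)`
with `L′ = E_v[A]`, `K = L′^⋆ = F_v ⊕ F_vκ ≅ F_v(√k₀) =: K₀` (★ `exists_nonscalar_hermStar_eq_sq_eq_smul`, `k₀ ∈ F_v` since `σk₀ = k₀`, non-square by ★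
`not_isSquare_of_kappa`).  The substitution `ω ↦ κ` is an `F_v`-algebra map `K₀ = QuadraticAlgebra F_v k₀ 0 → M₂(E_v)` (Mathlib `QuadraticAlgebra.lift`) onto `E_v[A]^⋆`, with
`det ∘ (ω ↦ κ) = ι_v ∘ N_{K₀∕F_v}` (★ `det_smul_one_add_smul_kappa`).  Hence:
* (N1) `exists_hermStar_eq_self_det_not_norm`: some `Y = Y⋆ ∈ E_v[A]` has `det Y ∉ N(E_v^×) = {σ(z)z}` — ★ `IsRegularHilbertField.exists_hilbertSymbol_norm_eq_neg_one_of_finrank_eq_two`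
  for the regular field `F_v` (★ `isRegularHilbertField_adicCompletion`) and `θ = d`, which is not a square in `K₀` (else `κ` would be scalar);
* (N2) `exists_eq_hermStar_mul_self_of_det_norm`: `Y = Y⋆ ∈ E_v[A]` with `det Y ∈ N(E_v^×)` is `S⋆S` for an invertible `S ∈ E_v[A]` — norm functoriality ★
  `mem_quadraticNormSubgroup_iff_norm_mem_of_finrank_adicCompletion_eq_two` gives `y = m² − d n²` in `K₀`, and `S = m̂ + δ n̂` has `S⋆S = m̂² − δ²n̂² = ŷ = Y`.
These are the injectivity and the non-triviality of `H¹(F_v, T_K) → H¹(F_v, U(2)) = F_v^×∕N(E_v^×)`; the sequel `LocalStableClassesNonsplitTypeTwoCount` turns them into «two classes».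

## References
* [Rogawski1990] J. D. Rogawski, *Automorphic Representations of Unitary Groups in Three Variables*, Ann. of Math. Stud. 123 (1990), §3.5 Prop. 3.5.2 (a)(c) p. 29, §3.6 p. 31.
* [Omeara1963] O. T. O'Meara, *Introduction to quadratic forms* (1963), §63B 63:13, 63:13a; §63C 63:20.
-/

set_option autoImplicit false

noncomputable section

open Matrix NumberField IsDedekindDomain
open scoped MatrixGroups

namespace Literature.NumberTheory.Rogawski1990

open Literature.NumberTheory.Automorphic Literature.NumberTheory.Automorphic.UnitaryGroup Literature.NumberTheory.QuadraticForms

section Local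

variable {F : Type} (E : Type) [Field F] [NumberField F] [Field E] [NumberField E] [Algebra F E]
  [Algebra.IsQuadraticExtension F E] (v : HeightOneSpectrum (𝓞 F)) (c : E ≃ₐ[F] E) {δ : E} (hcδ : c δ = -δ) (hδ : δ ≠ 0)
  {d : F} (hd : δ * δ = algebraMap F E d)

/-- `Algebra.norm` on `QuadraticAlgebra R a b` is its norm form (as in ★ `HilbertSymbolNormCompatLowDegree`, private there). [folklore] -/
private theorem algebraNorm_quadraticAlgebra {R : Type*} [CommRing R] (a b : R) (z : QuadraticAlgebra R a b) : Algebra.norm R z = z.norm := by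
  rw [Algebra.norm_apply, ← QuadraticAlgebra.det_toLinearMap_eq_norm]
  congr 1

/-- Elements of `span{1, κ}` commute. [folklore] -/
private theorem commute_smul_one_add_smul_kappa {R : Type*} [CommRing R] (κ : Matrix (Fin 2) (Fin 2) R) (a b a' b' : R) :
    (a • (1 : Matrix (Fin 2) (Fin 2) R) + b • κ) * (a' • 1 + b' • κ) = (a' • 1 + b' • κ) * (a • 1 + b • κ) := by
  simp only [add_mul, mul_add, smul_mul_assoc, mul_smul_comm, Matrix.one_mul, Matrix.mul_one]
  module

include hcδ hδ in
/-- **The substitution `ω ↦ κ` in matrix currency.**  For `κ ∈ M₂(E_v)` `⋆`-fixed with `κ² = ι_v(k) • 1` (`G` invertible) and the `F_v`-algebra map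
`φ : F_v(√k) → M₂(E_v)` with `φ z = ι_v(z.re) • 1 + ι_v(z.im) • κ`: `φ z` is `⋆`-fixed, and `det (φ z) = ι_v(N z)` when `κ` is non-scalar.
[cite: Rogawski1990, §3.5 Prop. 3.5.2 (a) p. 29] -/
theorem hermStar_eq_self_and_det_eq_of_kappa (w : PlacesOver E v) (hw : c • w.1 = w.1) {G κ : Matrix (Fin 2) (Fin 2) (LocalRing E v)} (hG : IsUnit G.det)
    (hκs : hermStar (conjLocal E c v) G κ = κ) (hκ : ∀ r : LocalRing E v, κ ≠ r • 1) {k : v.adicCompletion F}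
    (hsq : κ * κ = toLocalRing E v k • (1 : Matrix (Fin 2) (Fin 2) (LocalRing E v))) (z : QuadraticAlgebra (v.adicCompletion F) k 0) :
    hermStar (conjLocal E c v) G (toLocalRing E v z.re • (1 : Matrix (Fin 2) (Fin 2) (LocalRing E v)) + toLocalRing E v z.im • κ) =
        toLocalRing E v z.re • 1 + toLocalRing E v z.im • κ ∧
      (toLocalRing E v z.re • (1 : Matrix (Fin 2) (Fin 2) (LocalRing E v)) + toLocalRing E v z.im • κ).det =
        toLocalRing E v (Algebra.norm (v.adicCompletion F) z) := by
  letI : Field (LocalRing E v) := (Liu2021.LemD1IndexedNonVacuityNonsplitPlace.isField_localRing_of_nonsplit E v c hcδ hδ w hw).toField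
  refine ⟨?_, ?_⟩
  · rw [hermStar_smul_one_add_smul_kappa (conjLocal E c v) G hG hκs, conjLocal_toLocalRing, conjLocal_toLocalRing]
  · rw [det_smul_one_add_smul_kappa hsq hκ, algebraNorm_quadraticAlgebra, QuadraticAlgebra.norm_def]
    simp only [map_sub, map_add, map_mul, map_zero]
    ring

include hcδ hδ in
/-- `δ ⊗ 1 ∈ E_v` is non-zero and anti-fixed by `σ = c ⊗ 1`; `2 ≠ 0` in `E_v`; `σ` is an involution. [cite: CasselsFrohlichANT1967, Ch. II §10] -/
private theorem delta_local_facts :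
    conjLocal E c v (algebraMap E (LocalRing E v) δ) = -algebraMap E (LocalRing E v) δ ∧ algebraMap E (LocalRing E v) δ ≠ 0 ∧
      (2 : LocalRing E v) ≠ 0 ∧ ∀ x : LocalRing E v, conjLocal E c v (conjLocal E c v x) = x := by
  haveI : CharZero (v.adicCompletion F) := charZero_of_injective_algebraMap (algebraMap F _).injective
  refine ⟨by rw [conjLocal_algebraMap, hcδ, map_neg], (map_ne_zero (algebraMap E (LocalRing E v))).2 hδ, ?_,
    Liu2021.LemD1OfPlace.conjLocal_conjLocal_apply E v c hcδ hδ⟩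
  rw [show (2 : LocalRing E v) = toLocalRing E v 2 from (map_ofNat _ 2).symm]
  exact (map_ne_zero _).2 two_ne_zero

include hcδ hδ in
/-- **The square-root generator `κ` of `E_v[A]^⋆` with its square in `F_v`**: at a non-split place, for `A` unitary for the hermitian invertible `G ∈ M₂(E_v)` with
`χ_A` rootless, there is `κ = α₀ + β₀A` (`β₀ ≠ 0`), `κ⋆ = κ`, `κ² = ι_v(k) • 1` with `k ∈ F_v` NOT A SQUARE — so `E_v[A]^⋆ ≅ F_v(√k)` is a quadratic FIELD extension of
`F_v` (★ `exists_nonscalar_hermStar_eq_sq_eq_smul`, `σk₀ = k₀ ⇒ k₀ = ι_v k`, ★ `not_isSquare_of_kappa`). [cite: Rogawski1990, §3.6 p. 31; §3.5 Prop. 3.5.2 (a) p. 29] -/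
theorem exists_kappa_sq_eq_toLocalRing (w : PlacesOver E v) (hw : c • w.1 = w.1) {G A : Matrix (Fin 2) (Fin 2) (LocalRing E v)}
    (hGh : (G.map (conjLocal E c v))ᵀ = G) (hG : IsUnit G.det) (hAu : (A.map (conjLocal E c v))ᵀ * G * A = G)
    (hA : ∀ r : LocalRing E v, A.charpoly.eval r ≠ 0) :
    ∃ (α₀ β₀ : LocalRing E v) (k : v.adicCompletion F), β₀ ≠ 0 ∧
      hermStar (conjLocal E c v) G (α₀ • (1 : Matrix (Fin 2) (Fin 2) (LocalRing E v)) + β₀ • A) = α₀ • 1 + β₀ • A ∧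
      (α₀ • (1 : Matrix (Fin 2) (Fin 2) (LocalRing E v)) + β₀ • A) * (α₀ • 1 + β₀ • A) = toLocalRing E v k • (1 : Matrix (Fin 2) (Fin 2) (LocalRing E v)) ∧
      ¬ IsSquare k := by
  letI : Field (LocalRing E v) := (Liu2021.LemD1IndexedNonVacuityNonsplitPlace.isField_localRing_of_nonsplit E v c hcδ hδ w hw).toField
  obtain ⟨hδσ, hδ0, h2, hσσ⟩ := delta_local_facts E v c hcδ hδ
  obtain ⟨α₀, β₀, k₀, hβ₀, hκs, hsq, hk₀σ⟩ := exists_nonscalar_hermStar_eq_sq_eq_smul (conjLocal E c v) G hσσ hGh hG h2 hδσ hδ0 hA hAu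
  obtain ⟨k, hk⟩ := Liu2021.LemD1OfPlace.exists_toLocalRing_eq_of_conjLocal_eq E v c hcδ hδ k₀ hk₀σ
  refine ⟨α₀, β₀, k, hβ₀, hκs, by rw [hk]; exact hsq, ?_⟩
  rintro ⟨s, rfl⟩
  apply not_isSquare_of_kappa hA rfl hβ₀ hsq
  exact ⟨toLocalRing E v s, by rw [← hk, map_mul]⟩

include hcδ hδ hd in
/-- **`d = δ²` is not a square in `K₀ = F_v(√k)`** (`κ = α₀ + β₀A`, `β₀ ≠ 0`, `κ² = ι_v k`, `χ_A` rootless): a square root `q` of `d` in `K₀` would give, through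
`ω ↦ κ`, `(q̂ − δ)(q̂ + δ) = q̂² − δ² = 0` in the domain `E_v[A]`, so `q̂ = ±δ` would be a `σ`-FIXED scalar equal to `∓δ`, i.e. `δ = 0`. [cite: Rogawski1990, §3.6 p. 31] -/
theorem not_isSquare_algebraMap_delta_sq (w : PlacesOver E v) (hw : c • w.1 = w.1) {A : Matrix (Fin 2) (Fin 2) (LocalRing E v)}
    (hA : ∀ r : LocalRing E v, A.charpoly.eval r ≠ 0) {α₀ β₀ : LocalRing E v} {k : v.adicCompletion F} (hβ₀ : β₀ ≠ 0)
    (hsq : (α₀ • (1 : Matrix (Fin 2) (Fin 2) (LocalRing E v)) + β₀ • A) * (α₀ • 1 + β₀ • A) = toLocalRing E v k • (1 : Matrix (Fin 2) (Fin 2) (LocalRing E v)))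
    [Fact (∀ r : v.adicCompletion F, r ^ 2 ≠ k + 0 * r)] :
    ¬ IsSquare (algebraMap (v.adicCompletion F) (QuadraticAlgebra (v.adicCompletion F) k 0) (d : v.adicCompletion F)) := by
  letI : Field (LocalRing E v) := (Liu2021.LemD1IndexedNonVacuityNonsplitPlace.isField_localRing_of_nonsplit E v c hcδ hδ w hw).toField
  obtain ⟨hδσ, hδ0, h2, -⟩ := delta_local_facts E v c hcδ hδ
  have hκns : ∀ r : LocalRing E v, α₀ • (1 : Matrix (Fin 2) (Fin 2) (LocalRing E v)) + β₀ • A ≠ r • 1 :=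
    kappa_ne_smul_one rfl hβ₀ (ne_smul_one_of_eval_charpoly_ne_zero hA)
  have hδδ : algebraMap E (LocalRing E v) δ * algebraMap E (LocalRing E v) δ = toLocalRing E v (d : v.adicCompletion F) := by
    rw [← map_mul, hd, toLocalRing_coe]
  rintro ⟨q, hq⟩
  -- `q̂² = ι d • 1`
  have hre : q.re * q.re + k * q.im * q.im = (d : v.adicCompletion F) := by
    have h := congrArg QuadraticAlgebra.re hq
    rw [QuadraticAlgebra.algebraMap_re, QuadraticAlgebra.re_mul] at h
    exact h.symm
  have him : q.re * q.im + q.im * q.re = 0 := by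
    have h := congrArg QuadraticAlgebra.im hq
    rw [QuadraticAlgebra.im_mul] at h
    have h0 : (algebraMap (v.adicCompletion F) (QuadraticAlgebra (v.adicCompletion F) k 0) (d : v.adicCompletion F)).im = 0 := rfl
    rw [h0] at h
    linear_combination -h
  set a : LocalRing E v := toLocalRing E v q.re with ha
  set b : LocalRing E v := toLocalRing E v q.im with hb
  have hq2 : (a • (1 : Matrix (Fin 2) (Fin 2) (LocalRing E v)) + b • (α₀ • 1 + β₀ • A)) * (a • 1 + b • (α₀ • 1 + β₀ • A)) =
      (algebraMap E (LocalRing E v) δ * algebraMap E (LocalRing E v) δ) • (1 : Matrix (Fin 2) (Fin 2) (LocalRing E v)) := by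
    rw [smul_one_add_smul_kappa_mul hsq, hδδ, ha, hb, ← map_mul, ← map_mul, ← map_mul, ← map_add, ← hre, ← map_mul, ← map_mul, ← map_add, him,
      map_zero, zero_smul, add_zero]
  -- `(q̂ − δ)(q̂ + δ) = 0`
  have hprod : ((a - algebraMap E (LocalRing E v) δ) • (1 : Matrix (Fin 2) (Fin 2) (LocalRing E v)) + b • (α₀ • 1 + β₀ • A)) *
      ((a + algebraMap E (LocalRing E v) δ) • 1 + b • (α₀ • 1 + β₀ • A)) = 0 := by
    rw [smul_one_add_smul_kappa_mul hsq] at hq2 ⊢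
    rw [← sub_eq_zero] at hq2
    rw [← hq2]
    module
  have hdet := congrArg Matrix.det hprod
  rw [Matrix.det_mul, det_zero, mul_eq_zero] at hdet
  have hσa : conjLocal E c v a = a := by rw [ha, conjLocal_toLocalRing]
  -- both factors are `(a ∓ δ + bα₀) • 1 + (bβ₀) • A`; a vanishing determinant forces `b = 0` and `a = ±δ`
  have key : ∀ s : LocalRing E v, (((a + s) • (1 : Matrix (Fin 2) (Fin 2) (LocalRing E v)) + b • (α₀ • 1 + β₀ • A)).det = 0) → a + s = 0 := by
    intro s h
    have h' : ((a + s + b * α₀) • (1 : Matrix (Fin 2) (Fin 2) (LocalRing E v)) + (b * β₀) • A).det = 0 := by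
      rw [← h]
      congr 1
      module
    obtain ⟨h1, h2'⟩ := eq_zero_of_det_smul_one_add_smul_eq_zero hA h'
    rcases mul_eq_zero.1 h2' with h3 | h3
    · rwa [h3, zero_mul, add_zero] at h1
    · exact absurd h3 hβ₀
  have h2δ : (2 : LocalRing E v) * algebraMap E (LocalRing E v) δ ≠ 0 := mul_ne_zero h2 hδ0
  rcases hdet with h | h
  · have hα := key (-algebraMap E (LocalRing E v) δ) (by rw [← sub_eq_add_neg]; exact h)
    rw [← sub_eq_add_neg, sub_eq_zero] at hα
    rw [hα, hδσ] at hσa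
    exact h2δ (by linear_combination -hσa)
  · have hα := key (algebraMap E (LocalRing E v) δ) h
    rw [add_eq_zero_iff_eq_neg] at hα
    rw [hα, map_neg, hδσ, neg_neg] at hσa
    exact h2δ (by linear_combination hσa)

include hcδ hδ hd in
/-- **(N1) A `⋆`-SYMMETRIC ELEMENT OF `E_v[A]` WITH NON-NORM DETERMINANT EXISTS** (type (2), non-split `v`): for `A` unitary for the hermitian invertible `G ∈ M₂(E_v)`
with `χ_A` rootless there is `Y = α + βA` with `Y⋆ = Y`, `det Y` a unit and `det Y ≠ σ(z) z` for all units `z` — i.e. `H¹(F_v, T_K) → F_v^×∕N(E_v^×)`,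
`[Y] ↦ [det Y]`, is NOT trivial.  With `K₀ = F_v(√k) ≅ E_v[A]^⋆` (`exists_kappa_sq_eq_toLocalRing`) and `det = ι_v ∘ N_{K₀∕F_v}`: `d = δ²` is not a square in `K₀`
(`not_isSquare_algebraMap_delta_sq`), so ★ `IsRegularHilbertField.exists_hilbertSymbol_norm_eq_neg_one_of_finrank_eq_two` (regular `F_v`) gives `z ∈ K₀` with `(d, N z)_v = −1`.
[cite: Rogawski1990, §3.5 Prop. 3.5.2 (a)(c) p. 29; §3.6 p. 31] [cite: Omeara1963, §63B Prop. 63:13] -/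
theorem exists_hermStar_eq_self_det_not_norm (w : PlacesOver E v) (hw : c • w.1 = w.1) {G A : Matrix (Fin 2) (Fin 2) (LocalRing E v)}
    (hGh : (G.map (conjLocal E c v))ᵀ = G) (hG : IsUnit G.det) (hAu : (A.map (conjLocal E c v))ᵀ * G * A = G)
    (hA : ∀ r : LocalRing E v, A.charpoly.eval r ≠ 0) :
    ∃ α β : LocalRing E v, hermStar (conjLocal E c v) G (α • (1 : Matrix (Fin 2) (Fin 2) (LocalRing E v)) + β • A) = α • 1 + β • A ∧
      IsUnit (α • (1 : Matrix (Fin 2) (Fin 2) (LocalRing E v)) + β • A).det ∧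
      ¬ ∃ z : LocalRing E v, IsUnit z ∧ (α • (1 : Matrix (Fin 2) (Fin 2) (LocalRing E v)) + β • A).det = conjLocal E c v z * z := by
  letI : Field (LocalRing E v) := (Liu2021.LemD1IndexedNonVacuityNonsplitPlace.isField_localRing_of_nonsplit E v c hcδ hδ w hw).toField
  haveI : CharZero (v.adicCompletion F) := charZero_of_injective_algebraMap (algebraMap F _).injective
  haveI : NeZero (2 : v.adicCompletion F) := ⟨two_ne_zero⟩
  obtain ⟨α₀, β₀, k, hβ₀, hκs, hsq, hk⟩ := exists_kappa_sq_eq_toLocalRing E v c hcδ hδ w hw hGh hG hAu hA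
  have hκns : ∀ r : LocalRing E v, α₀ • (1 : Matrix (Fin 2) (Fin 2) (LocalRing E v)) + β₀ • A ≠ r • 1 :=
    kappa_ne_smul_one rfl hβ₀ (ne_smul_one_of_eval_charpoly_ne_zero hA)
  haveI := Literature.NumberTheory.Automorphic.fact_sq_ne_of_not_isSquare (v.adicCompletion F) k hk
  have hd0 : (d : v.adicCompletion F) ≠ 0 := by
    intro h
    have hd0' : d = 0 := (algebraMap F (v.adicCompletion F)).injective (by rw [map_zero]; exact h)
    rw [hd0', map_zero, mul_self_eq_zero] at hd
    exact hδ hd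
  have hdK := not_isSquare_algebraMap_delta_sq E v c hcδ hδ hd w hw hA hβ₀ hsq
  -- a `z ∈ K₀` with `(d, N z)_v = -1`
  obtain ⟨z, hz0, hzsym⟩ := (isRegularHilbertField_adicCompletion F v).exists_hilbertSymbol_norm_eq_neg_one_of_finrank_eq_two hd0 hdK
    (QuadraticAlgebra.finrank_eq_two k 0)
  obtain ⟨hYs, hYdet⟩ := hermStar_eq_self_and_det_eq_of_kappa E v c hcδ hδ w hw hG hκs hκns hsq z
  have hN0 : Algebra.norm (v.adicCompletion F) z ≠ 0 := Algebra.norm_ne_zero_iff.2 hz0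
  have e : (toLocalRing E v z.re + toLocalRing E v z.im * α₀) • (1 : Matrix (Fin 2) (Fin 2) (LocalRing E v)) + (toLocalRing E v z.im * β₀) • A =
      toLocalRing E v z.re • 1 + toLocalRing E v z.im • (α₀ • 1 + β₀ • A) := by
    simp only [smul_add, smul_smul, add_smul, add_assoc]
  refine ⟨toLocalRing E v z.re + toLocalRing E v z.im * α₀, toLocalRing E v z.im * β₀, ?_, ?_, ?_⟩
  · rw [e, hYs]
  · rw [e, hYdet]; exact (IsUnit.mk0 _ hN0).map _
  · rw [e, hYdet]
    rintro ⟨zz, hzz, hzzeq⟩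
    have hmem := (exists_toLocalRing_eq_norm_iff_mem E v c hcδ hδ hd hN0).1 ⟨zz, hzz, hzzeq⟩
    rw [← hilbertSymbol_eq_one_iff_mem_quadraticNormSubgroup hd0, Units.val_mk0, hilbertSymbol_comm] at hmem
    rw [hmem] at hzsym
    norm_num at hzsym

include hcδ hδ in
/-- The substitution `ω ↦ κ` is multiplicative: `ẑ · ŵ = (z w)^` (`κ² = ι_v k`). [cite: Rogawski1990, §3.6 p. 31] -/
private theorem hat_mul (w : PlacesOver E v) (hw : c • w.1 = w.1) {κ : Matrix (Fin 2) (Fin 2) (LocalRing E v)} {k : v.adicCompletion F}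
    (hsq : κ * κ = toLocalRing E v k • (1 : Matrix (Fin 2) (Fin 2) (LocalRing E v))) (z z' : QuadraticAlgebra (v.adicCompletion F) k 0) :
    (toLocalRing E v z.re • (1 : Matrix (Fin 2) (Fin 2) (LocalRing E v)) + toLocalRing E v z.im • κ) *
        (toLocalRing E v z'.re • 1 + toLocalRing E v z'.im • κ) =
      toLocalRing E v (z * z').re • 1 + toLocalRing E v (z * z').im • κ := by
  letI : Field (LocalRing E v) := (Liu2021.LemD1IndexedNonVacuityNonsplitPlace.isField_localRing_of_nonsplit E v c hcδ hδ w hw).toField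
  rw [smul_one_add_smul_kappa_mul hsq, QuadraticAlgebra.re_mul, QuadraticAlgebra.im_mul]
  simp only [map_add, map_mul, zero_mul, add_zero]

omit [Algebra.IsQuadraticExtension F E] in
/-- `ω ↦ κ` respects subtraction. [folklore] -/
private theorem hat_sub {κ : Matrix (Fin 2) (Fin 2) (LocalRing E v)} {k : v.adicCompletion F} (z z' : QuadraticAlgebra (v.adicCompletion F) k 0) :
    toLocalRing E v (z - z').re • (1 : Matrix (Fin 2) (Fin 2) (LocalRing E v)) + toLocalRing E v (z - z').im • κ =
      (toLocalRing E v z.re • 1 + toLocalRing E v z.im • κ) - (toLocalRing E v z'.re • 1 + toLocalRing E v z'.im • κ) := by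
  rw [QuadraticAlgebra.re_sub, QuadraticAlgebra.im_sub, map_sub, map_sub, sub_smul, sub_smul]
  abel

omit [Algebra.IsQuadraticExtension F E] in
/-- `ω ↦ κ` on `x • z`, `x ∈ F_v`: `(x • z)^ = ι_v x • ẑ`. [folklore] -/
private theorem hat_smul {κ : Matrix (Fin 2) (Fin 2) (LocalRing E v)} {k : v.adicCompletion F} (x : v.adicCompletion F)
    (z : QuadraticAlgebra (v.adicCompletion F) k 0) :
    toLocalRing E v (x • z).re • (1 : Matrix (Fin 2) (Fin 2) (LocalRing E v)) + toLocalRing E v (x • z).im • κ =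
      toLocalRing E v x • (toLocalRing E v z.re • 1 + toLocalRing E v z.im • κ) := by
  rw [QuadraticAlgebra.re_smul, QuadraticAlgebra.im_smul, smul_eq_mul, smul_eq_mul, map_mul, map_mul, smul_add, smul_smul, smul_smul]

include hcδ hδ hd in
/-- **(N2) A `⋆`-SYMMETRIC ELEMENT OF `E_v[A]` WITH NORM DETERMINANT IS A NORM `S⋆S`** (type (2), non-split `v`): for `A` unitary for the hermitian invertible
`G ∈ M₂(E_v)` with `χ_A` rootless and `Y = α + βA` with `Y⋆ = Y` and `det Y = σ(z) z` (`z` a unit), there is an invertible `S = α′ + β′A` with `Y = S⋆ S` — i.e.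
`H¹(F_v, T_K) → F_v^×∕N(E_v^×)`, `[Y] ↦ [det Y]`, is INJECTIVE (the norm functoriality of [Prop. 3.5.2 (a)]).  Reading `Y = ŷ`, `y ∈ K₀ = F_v(√k)` (`⋆`-fixed
coordinates are in `ι_v F_v`), `det Y = ι_v N(y) ∈ N(E_v^×)` gives `N y ∈ N(F_v(√d)^×)` (★ `exists_toLocalRing_eq_norm_iff_mem`), hence `y = m² − d n²` in `K₀` (★
`mem_quadraticNormSubgroup_iff_norm_mem_of_finrank_adicCompletion_eq_two`, the regular Hilbert field `K₀`), and `S := m̂ + δ n̂` has `S⋆ = m̂ − δ n̂`,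
`S⋆S = m̂² − δ² n̂² = ŷ = Y`. [cite: Rogawski1990, §3.5 Prop. 3.5.2 (a) p. 29; §3.6 p. 31] [cite: Omeara1963, §63C (63:20)] -/
theorem exists_eq_hermStar_mul_self_of_det_norm (w : PlacesOver E v) (hw : c • w.1 = w.1) {G A : Matrix (Fin 2) (Fin 2) (LocalRing E v)}
    (hGh : (G.map (conjLocal E c v))ᵀ = G) (hG : IsUnit G.det) (hAu : (A.map (conjLocal E c v))ᵀ * G * A = G)
    (hA : ∀ r : LocalRing E v, A.charpoly.eval r ≠ 0) {α β : LocalRing E v}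
    (hY : hermStar (conjLocal E c v) G (α • (1 : Matrix (Fin 2) (Fin 2) (LocalRing E v)) + β • A) = α • 1 + β • A)
    (hdet : ∃ z : LocalRing E v, IsUnit z ∧ (α • (1 : Matrix (Fin 2) (Fin 2) (LocalRing E v)) + β • A).det = conjLocal E c v z * z) :
    ∃ α' β' : LocalRing E v, IsUnit (α' • (1 : Matrix (Fin 2) (Fin 2) (LocalRing E v)) + β' • A).det ∧
      α • (1 : Matrix (Fin 2) (Fin 2) (LocalRing E v)) + β • A =
        hermStar (conjLocal E c v) G (α' • (1 : Matrix (Fin 2) (Fin 2) (LocalRing E v)) + β' • A) * (α' • 1 + β' • A) := by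
  letI : Field (LocalRing E v) := (Liu2021.LemD1IndexedNonVacuityNonsplitPlace.isField_localRing_of_nonsplit E v c hcδ hδ w hw).toField
  haveI : CharZero (v.adicCompletion F) := charZero_of_injective_algebraMap (algebraMap F _).injective
  haveI : NeZero (2 : v.adicCompletion F) := ⟨two_ne_zero⟩
  obtain ⟨hδσ, hδ0, h2, hσσ⟩ := delta_local_facts E v c hcδ hδ
  obtain ⟨α₀, β₀, k, hβ₀, hκs, hsq, hk⟩ := exists_kappa_sq_eq_toLocalRing E v c hcδ hδ w hw hGh hG hAu hA
  have hκns : ∀ r : LocalRing E v, α₀ • (1 : Matrix (Fin 2) (Fin 2) (LocalRing E v)) + β₀ • A ≠ r • 1 :=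
    kappa_ne_smul_one rfl hβ₀ (ne_smul_one_of_eval_charpoly_ne_zero hA)
  haveI := Literature.NumberTheory.Automorphic.fact_sq_ne_of_not_isSquare (v.adicCompletion F) k hk
  have hd0 : (d : v.adicCompletion F) ≠ 0 := by
    intro h
    have hd0' : d = 0 := (algebraMap F (v.adicCompletion F)).injective (by rw [map_zero]; exact h)
    rw [hd0', map_zero, mul_self_eq_zero] at hd
    exact hδ hd
  have hδδ : algebraMap E (LocalRing E v) δ * algebraMap E (LocalRing E v) δ = toLocalRing E v (d : v.adicCompletion F) := by
    rw [← map_mul, hd, toLocalRing_coe]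
  -- coordinates of `Y` on `1, κ` are `σ`-fixed, hence in `ι_v F_v`: `Y = ŷ`
  obtain ⟨a', b', hab⟩ := exists_eq_smul_one_add_smul_kappa (κ := α₀ • (1 : Matrix (Fin 2) (Fin 2) (LocalRing E v)) + β₀ • A) rfl hβ₀ α β
  have hfix : conjLocal E c v a' = a' ∧ conjLocal E c v b' = b' :=
    (hermStar_smul_one_add_smul_kappa_eq_self_iff (conjLocal E c v) G hG hκs hκns a' b').1 (by rw [← hab]; exact hY)
  obtain ⟨p, hp⟩ := Liu2021.LemD1OfPlace.exists_toLocalRing_eq_of_conjLocal_eq E v c hcδ hδ a' hfix.1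
  obtain ⟨q, hq⟩ := Liu2021.LemD1OfPlace.exists_toLocalRing_eq_of_conjLocal_eq E v c hcδ hδ b' hfix.2
  set y : QuadraticAlgebra (v.adicCompletion F) k 0 := ⟨p, q⟩ with hydef
  have hŷ : toLocalRing E v y.re • (1 : Matrix (Fin 2) (Fin 2) (LocalRing E v)) + toLocalRing E v y.im • (α₀ • 1 + β₀ • A) = α • 1 + β • A := by
    rw [hab, ← hp, ← hq]
  obtain ⟨-, hydet⟩ := hermStar_eq_self_and_det_eq_of_kappa E v c hcδ hδ w hw hG hκs hκns hsq y
  rw [hŷ] at hydet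
  -- `N y ∈ N(F_v(√d)ˣ)` by the unit-norm test, hence `y ∈ N(K₀(√d)ˣ)` by norm functoriality
  obtain ⟨zz, hzz, hzzeq⟩ := hdet
  have hN0 : Algebra.norm (v.adicCompletion F) y ≠ 0 := by
    intro h0
    rw [hydet, h0, map_zero] at hzzeq
    exact ((hzz.map (conjLocal E c v)).mul hzz).ne_zero hzzeq.symm
  have hy0 : y ≠ 0 := Algebra.norm_ne_zero_iff.1 hN0
  have hmemF : Units.mk0 _ hN0 ∈ quadraticNormSubgroup (v.adicCompletion F) (d : v.adicCompletion F) :=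
    (exists_toLocalRing_eq_norm_iff_mem E v c hcδ hδ hd hN0).1 ⟨zz, hzz, hydet ▸ hzzeq⟩
  have hmemK : Units.mk0 y hy0 ∈ quadraticNormSubgroup (QuadraticAlgebra (v.adicCompletion F) k 0)
      (algebraMap (v.adicCompletion F) _ (d : v.adicCompletion F)) := by
    rw [mem_quadraticNormSubgroup_iff_norm_mem_of_finrank_adicCompletion_eq_two F v (QuadraticAlgebra.finrank_eq_two k 0) hd0]
    have hu : Units.map (Algebra.norm (v.adicCompletion F) : QuadraticAlgebra (v.adicCompletion F) k 0 →* v.adicCompletion F) (Units.mk0 y hy0) =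
        Units.mk0 _ hN0 := Units.ext rfl
    rw [hu]
    exact hmemF
  obtain ⟨m, n, hmn⟩ := mem_quadraticNormSubgroup_iff.1 hmemK
  rw [Units.val_mk0] at hmn
  -- `S := m̂ + δ n̂`
  obtain ⟨hms, -⟩ := hermStar_eq_self_and_det_eq_of_kappa E v c hcδ hδ w hw hG hκs hκns hsq m
  obtain ⟨hns, -⟩ := hermStar_eq_self_and_det_eq_of_kappa E v c hcδ hδ w hw hG hκs hκns hsq n
  set κ : Matrix (Fin 2) (Fin 2) (LocalRing E v) := α₀ • 1 + β₀ • A with hκdef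
  obtain ⟨mh, hmh⟩ : ∃ M : Matrix (Fin 2) (Fin 2) (LocalRing E v), M = toLocalRing E v m.re • 1 + toLocalRing E v m.im • κ := ⟨_, rfl⟩
  obtain ⟨nh, hnh⟩ : ∃ M : Matrix (Fin 2) (Fin 2) (LocalRing E v), M = toLocalRing E v n.re • 1 + toLocalRing E v n.im • κ := ⟨_, rfl⟩
  rw [← hmh] at hms
  rw [← hnh] at hns
  obtain ⟨δR, hδR⟩ : ∃ r : LocalRing E v, r = algebraMap E (LocalRing E v) δ := ⟨_, rfl⟩
  rw [← hδR] at hδσ hδδ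
  have hSstar : hermStar (conjLocal E c v) G (mh + δR • nh) = mh - δR • nh := by
    rw [hermStar_add, hermStar_smul, hms, hns, hδσ, neg_smul, sub_eq_add_neg]
  have hcomm : mh * nh = nh * mh := by rw [hmh, hnh]; exact commute_smul_one_add_smul_kappa κ _ _ _ _
  have hprod : (mh - δR • nh) * (mh + δR • nh) = α • 1 + β • A := by
    have e1 : (mh - δR • nh) * (mh + δR • nh) = mh * mh - (δR * δR) • (nh * nh) := by
      simp only [sub_mul, mul_add, mul_smul_comm, smul_mul_assoc, hcomm]
      module
    have h1 : mh * mh = toLocalRing E v (m * m).re • 1 + toLocalRing E v (m * m).im • κ := by rw [hmh]; exact hat_mul E v c hcδ hδ w hw hsq m m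
    have h2 : nh * nh = toLocalRing E v (n * n).re • 1 + toLocalRing E v (n * n).im • κ := by rw [hnh]; exact hat_mul E v c hcδ hδ w hw hsq n n
    have h3 : m * m - (d : v.adicCompletion F) • (n * n) = y := by rw [← hmn, Algebra.smul_def, sq, sq]
    rw [e1, h1, h2, hδδ, ← hat_smul, ← hat_sub, h3, hŷ]
  have eS : ((toLocalRing E v m.re + δR * toLocalRing E v n.re) + (toLocalRing E v m.im + δR * toLocalRing E v n.im) * α₀) •
        (1 : Matrix (Fin 2) (Fin 2) (LocalRing E v)) + ((toLocalRing E v m.im + δR * toLocalRing E v n.im) * β₀) • A = mh + δR • nh := by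
    rw [hmh, hnh, hκdef]
    module
  refine ⟨(toLocalRing E v m.re + δR * toLocalRing E v n.re) + (toLocalRing E v m.im + δR * toLocalRing E v n.im) * α₀,
    (toLocalRing E v m.im + δR * toLocalRing E v n.im) * β₀, ?_, ?_⟩
  · -- `det S⋆ · det S = det Y` is a unit
    rw [eS]
    have hdet2 : (hermStar (conjLocal E c v) G (mh + δR • nh)).det * (mh + δR • nh).det = conjLocal E c v zz * zz := by
      rw [← Matrix.det_mul, hSstar, hprod, hzzeq]
    exact isUnit_of_mul_isUnit_right (hdet2 ▸ (hzz.map (conjLocal E c v)).mul hzz)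
  · rw [eS, hSstar, hprod]

end Local

end Literature.NumberTheory.Rogawski1990
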